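import Literature.Topology.FourManifolds.KirbyMovesSlideEndStraighten
import Literature.Topology.FourManifolds.StraightLineAmbientIsotopySupport
import Literature.Topology.FourManifolds.AmbientIsotopyTransport
import Mathlib.Topology.MetricSpace.Thickening
import HarnessLib

/-!
# Normalising the band end, step B: flattening the band at the push-off

Topic `Literature/Topology/FourManifolds`; fact seat `provefact-IsStrictHandleSlide.isSurgery`
(R. C. Kirby, *The Topology of 4-Manifolds*, LNM 1374 (1989), Ch. I §4; remaining content: the
named fact (S) `Literature.Topology.FourManifolds.FramedLink.IsStrictHandleSlide.slideModel`).
Step B of the normalisation of the slide band at the push-off `Kⱼ'`: an ambient isotopy `H` of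
`S³`, all of whose stages are the identity off any prescribed open `N₀ ⊇ Kⱼ'`, whose end fixes
`Kⱼ'` pointwise and carries
the band near its right edge (heights `[h₁, h₂]`, `x₀ ∈ [1 - κ, 1]`) onto its **flat model**
`thickeningFlat (x, 0) = ν (circlePt (thetaB x₁), (1 + (1 - x₀) κ(x₁)) • e₀)` — provided the band
already leaves `Kⱼ'` radially along `[h₁ - ε, h₂ + ε]` (step A, `BandCore.exists_stepA`). Proof:
the straightening map of `KirbyMovesSlideEndStraighten.lean` in a chart `σ : S³ ⊇ U ≅ ℝ³` with
full target containing `ν (S¹ × ℝ²)`, the straight-line isotopy extension with support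
(`exists_ambientIsotopy_of_straightLine_of_subset`) and transport back to `S³`
(`AmbientIsotopy.chartTransport`) — the argument of the uniqueness of tubular neighbourhoods,
Kosinski (1993), III.(3.5), as in `LinkTubularUniqueness.lean`. Proved here (no definitions,
no named facts):

* `BandCore.exists_stepB`.

## References

* R. C. Kirby, *The Topology of 4-Manifolds*, LNM 1374, Springer (1989), Ch. I §4. [Kirby1989]
* A. Kosinski, *Differential Manifolds* (1993), Ch. II (5.2), Ch. III, Thm. (3.5). [Kosinski1993]
* M. W. Hirsch, *Differential Topology* (1976), Ch. 8 §1, Thm. 1.3. [HirschDT1976]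
-/

open scoped Manifold ContDiff Topology
open Function Set Metric Filter

noncomputable section

namespace Literature.Topology.FourManifolds

namespace BandCore

variable [Knot.TubularNbhd.SmoothnessFacts] {A Kj : Knot} (ν : Knot.TubularNbhd Kj)
  {avoid : Set (Metric.sphere (0 : EuclideanSpace ℝ (Fin 4)) 1)} (b : BandCore A ν.pushOff avoid)
  {σ : OpenPartialHomeomorph (Metric.sphere (0 : EuclideanSpace ℝ (Fin 4)) 1) (EuclideanSpace ℝ (Fin 3))}

omit [Knot.TubularNbhd.SmoothnessFacts] in
/-- In the plane, a point whose first coordinate is within `κ` of `1` is within `κ` of the edge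
point at the same height. [folklore] -/
theorem dist_pt2_one_le (x : EuclideanSpace ℝ (Fin 2)) :
    dist x (pt2 1 (x 1)) = |x 0 - 1| := by
  rw [EuclideanSpace.dist_eq, Fin.sum_univ_two]
  have h0 : (pt2 1 (x 1) : EuclideanSpace ℝ (Fin 2)) 0 = 1 := rfl
  have h1 : (pt2 1 (x 1) : EuclideanSpace ℝ (Fin 2)) 1 = x 1 := rfl
  rw [h0, h1, dist_self, Real.dist_eq]
  simp [Real.sqrt_sq_eq_abs]

/-- **Step B of the normalisation of the band end.** See the module docstring.
[cite: Kosinski1993, Ch. III Thm (3.5)] -/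
theorem exists_stepB (hσ : ContMDiffOn (𝓡 3) 𝓘(ℝ, EuclideanSpace ℝ (Fin 3)) ∞ σ σ.source)
    (hσs : ContMDiff 𝓘(ℝ, EuclideanSpace ℝ (Fin 3)) (𝓡 3) ∞ σ.symm) (hσt : σ.target = univ)
    (hνσ : ∀ q, ν q ∈ σ.source)
    {h₁ h₂ ε : ℝ} (hε : 0 < ε) (hlo : 10⁻¹ < h₁ - ε) (hle : h₁ ≤ h₂) (hhi : h₂ + ε < 9 / 10)
    (hA : ∀ y ∈ Icc (h₁ - ε) (h₂ + ε),
      fderiv ℝ (b.tubeNormal ν) (pt2 1 y) (pt2 1 0) = (-b.edgeRate ν y) • framingBaseVector)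
    (hpos : ∀ y ∈ Icc (h₁ - ε) (h₂ + ε), 0 < b.edgeRate ν y)
    {N₀ : Set (Metric.sphere (0 : EuclideanSpace ℝ (Fin 4)) 1)} (hN₀ : IsOpen N₀) (hPN₀ : range ⇑ν.pushOff ⊆ N₀) :
    ∃ (H : AmbientIsotopy (𝓡 3) (Metric.sphere (0 : EuclideanSpace ℝ (Fin 4)) 1)) (κ : ℝ),
      0 < κ ∧ (∀ t x, x ∉ N₀ → H.toFun t x = x) ∧ (∀ u, H.toFun 1 (ν.pushOff u) = ν.pushOff u) ∧
      ∀ x : EuclideanSpace ℝ (Fin 2), x 0 ∈ Icc (1 - κ) 1 → x 1 ∈ Icc h₁ h₂ →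
        H.toFun 1 (b.band x) = b.thickeningFlat ν (x, 0) := by
  obtain ⟨P, G, hPs, hGo, hGseg, hGdom, hPfix, hderiv, hPflat⟩ :=
    b.exists_straighteningMap ν hσ hσs hνσ hε hlo hle hhi hA hpos
  -- the compact set `Z = σ (Kⱼ')` and the derivative field on it
  set Z : Set (EuclideanSpace ℝ (Fin 3)) := σ '' range ⇑ν.pushOff with hZ
  have hPsrc : range ⇑ν.pushOff ⊆ σ.source := by
    rintro _ ⟨u, rfl⟩; rw [Knot.TubularNbhd.pushOff_apply]; exact hνσ _
  have hZc : IsCompact Z := (isCompact_range ν.pushOff.continuous).image_of_continuousOn (hσ.continuousOn.mono hPsrc)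
  have hZex : ∀ z ∈ Z, ∃ D : EuclideanSpace ℝ (Fin 3) →L[ℝ] EuclideanSpace ℝ (Fin 3),
      HasFDerivAt P D z ∧ ∀ t ∈ Icc (0 : ℝ) 1, Injective (slDeriv t D) := by
    rintro _ ⟨_, ⟨u, rfl⟩, rfl⟩; exact hderiv u
  choose! D hD using hZex
  have hPZ : ∀ z ∈ Z, P z = z := by rintro _ ⟨_, ⟨u, rfl⟩, rfl⟩; exact hPfix u
  -- the support set `W' = σ (N₀ ∩ σ.source)`
  set W' : Set (EuclideanSpace ℝ (Fin 3)) := σ '' (N₀ ∩ σ.source) with hW'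
  have hW'o : IsOpen W' := σ.isOpen_image_of_subset_source (hN₀.inter σ.open_source) inter_subset_right
  have hZW' : Z ⊆ W' := by
    rintro _ ⟨p, hp, rfl⟩; exact ⟨p, ⟨hPN₀ hp, hPsrc hp⟩, rfl⟩
  -- straight-line isotopy extension with support in `W'`, as an ambient isotopy
  obtain ⟨Ψ, hΨP, hΨW', R, hΨR⟩ := exists_ambientIsotopy_of_straightLine_of_subset hZc isOpen_univ
    (subset_univ Z) hPs.contDiffOn hPZ (fun z hz ↦ (hD z hz).1) (fun z hz ↦ (hD z hz).2) hW'o hZW'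
  -- transport to `S³`
  have hRt : closedBall (0 : EuclideanSpace ℝ (Fin 3)) R ⊆ σ.target := by rw [hσt]; exact subset_univ _
  set H := Ψ.chartTransport σ hσ hσs.contMDiffOn hRt hΨR with hHdef
  -- where `Ψ 1 = P`
  obtain ⟨U, hUo, hZU, hUP⟩ := mem_nhdsSet_iff_exists.1 hΨP
  -- `H` through the chart
  have hHsrc : ∀ t, ∀ x ∈ σ.source, H.toFun t x = σ.symm (Ψ.toFun t (σ x)) := fun t x hx ↦
    AmbientIsotopy.chartTransport_toFun_of_mem hσ hσs.contMDiffOn hRt Ψ hΨR t hx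
  have hHout : ∀ t x, x ∉ σ.source → H.toFun t x = x := fun t x hx ↦
    AmbientIsotopy.chartTransport_toFun_of_not_mem hσ hσs.contMDiffOn hRt Ψ hΨR t hx
  refine ⟨H, ?_⟩
  -- the width `κ` by the tube lemma around the edge segment inside the open set `S`
  set S : Set (EuclideanSpace ℝ (Fin 2)) := G ∩ (fun x ↦ σ (b.band x)) ⁻¹' U with hS
  have hbandsrc : ∀ x ∈ G, b.band x ∈ σ.source := fun x hx ↦ by
    obtain ⟨q, hq⟩ := (hGdom hx).1
    rw [← hq]; exact hνσ _
  have hcont : ContinuousOn (fun x ↦ σ (b.band x)) G :=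
    hσ.continuousOn.comp b.contMDiff.continuous.continuousOn hbandsrc
  have hSo : IsOpen S := hcont.isOpen_inter_preimage hGo hUo
  set K' : Set (EuclideanSpace ℝ (Fin 2)) := (fun y : ℝ ↦ (pt2 1 y : EuclideanSpace ℝ (Fin 2))) '' Icc h₁ h₂ with hK'
  have hline : Continuous (fun y : ℝ ↦ (pt2 1 y : EuclideanSpace ℝ (Fin 2))) := by
    have : ContDiff ℝ ∞ (fun y : ℝ ↦ (pt2 1 y : EuclideanSpace ℝ (Fin 2))) := by
      rw [contDiff_euclidean]; intro i; fin_cases i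
      · exact contDiff_const
      · exact contDiff_id
    exact this.continuous
  have hK'c : IsCompact K' := isCompact_Icc.image hline
  have hyI : ∀ y ∈ Icc h₁ h₂, y ∈ Icc (10⁻¹ : ℝ) (9 / 10) := fun y hy ↦ ⟨by linarith [hy.1], by linarith [hy.2]⟩
  have hK'S : K' ⊆ S := by
    rintro _ ⟨y, hy, rfl⟩
    refine ⟨hGseg y hy, ?_⟩
    show σ (b.band (pt2 1 y)) ∈ U
    apply hZU
    refine ⟨ν.pushOff (circlePt (b.thetaB y)), ⟨_, rfl⟩, ?_⟩
    rw [b.apply_circlePt_thetaB (hyI y hy)]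
  obtain ⟨δ, hδ, hδS⟩ := hK'c.exists_cthickening_subset_open hSo hK'S
  refine ⟨δ / 2, by positivity, fun t x hx ↦ ?_, fun u ↦ ?_, fun x hx0 hx1 ↦ ?_⟩
  · -- identity off `N₀`
    by_cases hxs : x ∈ σ.source
    · rw [hHsrc t x hxs]
      have hnot : σ x ∉ W' := by
        rintro ⟨x', ⟨hx'N, hx's⟩, hxx⟩
        exact hx ((σ.injOn hx's hxs hxx) ▸ hx'N)
      rw [hΨW' t _ hnot, σ.left_inv hxs]
    · exact hHout t x hxs
  · -- `Kⱼ'` is fixed by the end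
    have hxs : ν.pushOff u ∈ σ.source := hPsrc ⟨u, rfl⟩
    rw [hHsrc 1 _ hxs]
    have hzZ : σ (ν.pushOff u) ∈ Z := ⟨_, ⟨u, rfl⟩, rfl⟩
    rw [hUP (hZU hzZ), hPZ _ hzZ, σ.left_inv hxs]
  · -- flattening on the strip
    have hxS : x ∈ S := by
      apply hδS
      refine Metric.mem_cthickening_of_dist_le x (pt2 1 (x 1)) δ K' ⟨x 1, hx1, rfl⟩ ?_
      rw [dist_pt2_one_le]
      have : |x 0 - 1| ≤ δ / 2 := by rw [abs_le]; constructor <;> linarith [hx0.1, hx0.2]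
      linarith
    have hxG : x ∈ G := hxS.1
    have hxs : b.band x ∈ σ.source := hbandsrc x hxG
    rw [hHsrc 1 _ hxs, hUP hxS.2, hPflat x hxG]
    exact σ.left_inv (by
      rw [b.thickeningFlat_zero ν]
      exact hνσ _)

end BandCore

end Literature.Topology.FourManifolds
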